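import Summits.ResolutionOfSingularities.ResolutionOfSingularities.Theses.Descent
import Literature.AlgebraicGeometry.Resolution.ResolutionOfCurves
import Literature.AlgebraicGeometry.Resolution.SurfaceResolutionReduction
import Literature.AlgebraicGeometry.Resolution.LipmanTermination

/-!
# `DescentPerfectToAll` (stmt-ResolutionOfSingularities-0549) in low dimension: the curve case is a
# theorem, and the crux is its own dimension `≥ 2` part

Route `ResolutionOfSingularities/Descent`, crux `DescentPerfectToAll` ("for a prime `p`, resolution of
all reduced separated schemes of finite type over all PERFECT fields of characteristic `p` implies
`ResolutionInChar p`, i.e. resolution over ALL fields of characteristic `p`"). Helper file (OURS; it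
replaces the role of no printed item and is NOT a statement of any manuscript): the kill test "curve
case" of the rescue rung B (LADDER-RESOLUTION, L-G8 W8.1).

The point of the curve case is the wording of the summit: `Scheme.HasResolution X` asks for a proper
birational `X' ⟶ X` with `X'` REGULAR (all stalks regular local rings), not smooth over the ground
field. Over an imperfect field `k` the normalization of a reduced curve is regular but in general not
smooth (Kollár 2007, 1.19: `y^q = x^p - t` over `𝔽_p(t)`; tree barrier
`Literature.Barriers.ResolutionOfSingularities.RegularNotGeometricallyRegular`), and regular is all the
summit wants. Hence in dimension `≤ 1` the CONCLUSION of the crux holds outright over every field —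
the tree proves resolution of reduced curves by normalization (`ResolutionOfCurves.lean`:
E. Noether's finiteness of integral closure `NoetherFiniteIntegralClosure_holds`, normal Noetherian
local rings of dimension `≤ 1` are regular) — and the perfect-field hypothesis is idle there.

## Content (namespace `Summit.ResolutionOfSingularities.ResolutionOfSingularities.Theorems`)

* `isResolution_normalizationι_of_dim_le_one` — for an INTEGRAL scheme locally of finite type over any
  field with `dim X ≤ 1`, the normalization `X^ν ⟶ X` IS a resolution of singularities
  (`IsResolution`: proper — indeed finite —, birational, regular source).
* `hasResolution_of_dim_le_one` — the conclusion of the crux for reduced `X` of dimension `≤ 1` over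
  any field of any characteristic (restated at the crux's universe `0` from
  `Literature.AlgebraicGeometry.Resolution.resolutionInChar_dim_le_one`).
* `descentPerfectToAll_dimLEOne` — the crux `DescentPerfectToAll` with the extra hypothesis
  `topologicalKrullDim X ≤ 1` on the scheme to be resolved: PROVED (the antecedent is not used).
* `descentPerfectToAll_of_dimGtOne` — **reduction**: `DescentPerfectToAll` follows from its own
  restriction to schemes of dimension `> 1`; unconditional.
* `descentPerfectToAll_of_dimGtTwo` — the same with threshold `2`, modulo the tree's named fact
  `Lipman1978SequenceFinite` (Lipman 1978 = Liu 2002 Thm. 8.3.44, restricted to normal surfaces over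
  fields; `LipmanTermination.lean`), through `cossartJannsenSaito2020_of_lipmanTermination`.
* `descentPerfectToAll_of_dimGtThree` — threshold `3`, modulo the named fact `CossartPiltant2019`
  (the disprover's `crux_iff_dim_gt_three`, `Cruxes/DescentPerfectToAll/Disproof.lean` §1, in
  Theorems form).

No new mathematics: compositions of tree theorems; the two conditional reductions take published
theorems as explicit hypotheses (named facts of the tree, not discharged here).
-/

noncomputable section

set_option linter.dupNamespace false -- mandated namespace of this single-conjunct summit

open CategoryTheory CategoryTheory.Limits AlgebraicGeometry
open Literature.AlgebraicGeometry.Resolution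

namespace Summit.ResolutionOfSingularities.ResolutionOfSingularities.Theorems

/-! ## The curve case: normalization is a resolution -/

/-- **Normalization resolves integral curves over any field.** For an integral scheme `X` locally of
finite type over a field `k` (any characteristic, `k` possibly imperfect) with `dim X ≤ 1`, the
normalization `X^ν ⟶ X` is a resolution of singularities in the summit's sense: proper (it is
finite, E. Noether), birational (an isomorphism over a non-empty normal affine open) and `X^ν` is
regular (normal Noetherian local rings of dimension `≤ 1` are regular) — regular, not necessarily
smooth over `k`. [cite: Kollar2007, Thm. 1.30, Thm. 1.33 and 1.19] -/
theorem isResolution_normalizationι_of_dim_le_one (X : Scheme.{0}) [IsIntegral X] {k : Type}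
    [Field k] (f : X ⟶ Spec (.of k)) [LocallyOfFiniteType f] (hdim : topologicalKrullDim X ≤ 1) :
    IsResolution (normalizationι X) := by
  haveI : IsFinite (normalizationι X) := isFinite_normalizationι X NoetherFiniteIntegralClosure_holds f
  exact ⟨inferInstance, isBirational_normalizationι X f,
    isRegular_normalization_of_dim_le_one X NoetherFiniteIntegralClosure_holds f hdim⟩

/-- **The conclusion of `DescentPerfectToAll` holds outright in dimension `≤ 1`.** Every reduced
scheme of finite type over any field (separatedness and the characteristic are irrelevant) of
dimension `≤ 1` has a resolution of singularities — the disjoint union of the normalizations of its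
irreducible components, a finite birational regular model. [cite: Hartshorne1977, Ch. V Rem. 3.8.1] -/
theorem hasResolution_of_dim_le_one {k : Type} [Field k] (X : Scheme.{0}) (f : X ⟶ Spec (.of k))
    [LocallyOfFiniteType f] [QuasiCompact f] [IsReduced X] (hdim : topologicalKrullDim X ≤ 1) :
    Scheme.HasResolution X :=
  Literature.AlgebraicGeometry.Resolution.hasResolution_of_dim_le_one X f hdim

/-- **Finite resolution of reduced curves.** In dimension `≤ 1` the resolution may be taken FINITE
(not merely proper) over `X`. [cite: Hartshorne1977, Ch. V Rem. 3.8.1] -/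
theorem exists_finite_resolution_of_dim_le_one {k : Type} [Field k] (X : Scheme.{0})
    (f : X ⟶ Spec (.of k)) [LocallyOfFiniteType f] [QuasiCompact f] [IsReduced X]
    (hdim : topologicalKrullDim X ≤ 1) :
    ∃ (X' : Scheme.{0}) (π : X' ⟶ X), IsFinite π ∧ IsBirational π ∧ Scheme.IsRegular X' :=
  exists_finite_resolution_of_dim_le_one' X f hdim

/-- **The curve case of the crux `DescentPerfectToAll` (stmt-ResolutionOfSingularities-0549).** The
crux with the extra hypothesis `dim X ≤ 1` on the scheme to be resolved over the arbitrary field `k`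
of characteristic `p` holds — and its antecedent (resolution over all perfect fields of
characteristic `p`) is not needed: the kill test "curve case" of rung B is ALIVE because the summit
asks for a regular, not a smooth, model. [folklore] -/
theorem descentPerfectToAll_dimLEOne :
    ∀ p : ℕ, p.Prime → (∀ (k : Type) [Field k] [CharP k p] [PerfectField k] (X : Scheme.{0})
      (f : X ⟶ Spec (.of k)), IsSeparated f → LocallyOfFiniteType f → QuasiCompact f →
        IsReduced X → Scheme.HasResolution X) →
    ∀ (k : Type) [Field k] [CharP k p] (X : Scheme.{0}) (f : X ⟶ Spec (.of k)),
      IsSeparated f → LocallyOfFiniteType f → QuasiCompact f → IsReduced X →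
        topologicalKrullDim X ≤ 1 → Scheme.HasResolution X :=
  fun p _ _ k _ _ X f a b c d hdim => resolutionInChar_dim_le_one p k X f a b c d hdim

/-! ## The crux is its own dimension `≥ 2` part (and `≥ 3`, `≥ 4` modulo named facts) -/

/-- **Reduction of `DescentPerfectToAll` to dimension `≥ 2`, unconditionally.** If resolution over
all perfect fields of characteristic `p` yields a resolution of every reduced separated scheme of
finite type of dimension `> 1` over every field of characteristic `p`, then `DescentPerfectToAll`
holds: curves are resolved by normalization over any field. [folklore] -/
theorem descentPerfectToAll_of_dimGtOne
    (h : ∀ p : ℕ, p.Prime → (∀ (k : Type) [Field k] [CharP k p] [PerfectField k] (X : Scheme.{0})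
      (f : X ⟶ Spec (.of k)), IsSeparated f → LocallyOfFiniteType f → QuasiCompact f →
        IsReduced X → Scheme.HasResolution X) →
      ∀ (k : Type) [Field k] [CharP k p] (X : Scheme.{0}) (f : X ⟶ Spec (.of k)),
        IsSeparated f → LocallyOfFiniteType f → QuasiCompact f → IsReduced X →
          1 < topologicalKrullDim X → Scheme.HasResolution X) :
    Summit.ResolutionOfSingularities.ResolutionOfSingularities.Theses.Descent.DescentPerfectToAll := by
  intro p hp H k _ _ X f a b c d
  by_cases hdim : topologicalKrullDim X ≤ 1
  · exact resolutionInChar_dim_le_one p k X f a b c d hdim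
  · exact h p hp H k X f a b c d (not_le.mp hdim)

/-- **Reduction of `DescentPerfectToAll` to dimension `≥ 3`, modulo Lipman's theorem.** Taking as a
hypothesis the tree's named fact `Lipman1978SequenceFinite` (Lipman 1978 / Liu 2002, Thm. 8.3.44:
the normalized-blow-up sequence of a normal surface over a field terminates), reduced separated
surfaces over every field are resolved (`cossartJannsenSaito2020_of_lipmanTermination`), so the
crux follows from its restriction to schemes of dimension `> 2`.
[cite: Liu2002, Thm. 8.3.44] -/
theorem descentPerfectToAll_of_dimGtTwo (hL : Lipman1978SequenceFinite.{0})
    (h : ∀ p : ℕ, p.Prime → (∀ (k : Type) [Field k] [CharP k p] [PerfectField k] (X : Scheme.{0})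
      (f : X ⟶ Spec (.of k)), IsSeparated f → LocallyOfFiniteType f → QuasiCompact f →
        IsReduced X → Scheme.HasResolution X) →
      ∀ (k : Type) [Field k] [CharP k p] (X : Scheme.{0}) (f : X ⟶ Spec (.of k)),
        IsSeparated f → LocallyOfFiniteType f → QuasiCompact f → IsReduced X →
          2 < topologicalKrullDim X → Scheme.HasResolution X) :
    Summit.ResolutionOfSingularities.ResolutionOfSingularities.Theses.Descent.DescentPerfectToAll := by
  intro p hp H k _ _ X f a b c d
  by_cases hdim : topologicalKrullDim X ≤ 2
  · exact hL.cossartJannsenSaito2020 k X f a b c d (by exact_mod_cast hdim)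
  · exact h p hp H k X f a b c d (not_le.mp hdim)

/-- **Resolution of reduced surfaces over any field, modulo Lipman's theorem**, in the shape of the
crux's conclusion with `dim X ≤ 2`: the perfect-field antecedent is again idle.
[cite: Liu2002, Thm. 8.3.44] -/
theorem descentPerfectToAll_dimLETwo (hL : Lipman1978SequenceFinite.{0}) :
    ∀ p : ℕ, p.Prime → (∀ (k : Type) [Field k] [CharP k p] [PerfectField k] (X : Scheme.{0})
      (f : X ⟶ Spec (.of k)), IsSeparated f → LocallyOfFiniteType f → QuasiCompact f →
        IsReduced X → Scheme.HasResolution X) →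
    ∀ (k : Type) [Field k] [CharP k p] (X : Scheme.{0}) (f : X ⟶ Spec (.of k)),
      IsSeparated f → LocallyOfFiniteType f → QuasiCompact f → IsReduced X →
        topologicalKrullDim X ≤ 2 → Scheme.HasResolution X :=
  fun _ _ _ k _ _ X f a b c d hdim => hL.cossartJannsenSaito2020 k X f a b c d (by exact_mod_cast hdim)

/-- **Reduction of `DescentPerfectToAll` to dimension `≥ 4`, modulo Cossart–Piltant.** Taking as a
hypothesis the named fact `CossartPiltant2019` (reduced separated schemes of finite type of dimension
`≤ 3` over any field have a resolution), the crux follows from its restriction to schemes of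
dimension `> 3` — the Theorems-side form of the disprover's `crux_iff_dim_gt_three`.
[cite: CossartPiltant2019, Thm. 1.1] -/
theorem descentPerfectToAll_of_dimGtThree (hCP : CossartPiltant2019.{0})
    (h : ∀ p : ℕ, p.Prime → (∀ (k : Type) [Field k] [CharP k p] [PerfectField k] (X : Scheme.{0})
      (f : X ⟶ Spec (.of k)), IsSeparated f → LocallyOfFiniteType f → QuasiCompact f →
        IsReduced X → Scheme.HasResolution X) →
      ∀ (k : Type) [Field k] [CharP k p] (X : Scheme.{0}) (f : X ⟶ Spec (.of k)),
        IsSeparated f → LocallyOfFiniteType f → QuasiCompact f → IsReduced X →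
          3 < topologicalKrullDim X → Scheme.HasResolution X) :
    Summit.ResolutionOfSingularities.ResolutionOfSingularities.Theses.Descent.DescentPerfectToAll := by
  intro p hp H k _ _ X f a b c d
  by_cases hdim : topologicalKrullDim X ≤ 3
  · haveI := a; haveI := b; haveI := c; haveI := d
    exact hasResolution_of_dim_le_three hCP k X f hdim
  · exact h p hp H k X f a b c d (not_le.mp hdim)

end Summit.ResolutionOfSingularities.ResolutionOfSingularities.Theorems

end
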